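import Summits.CriticalPhenomena.PercolationContinuityZ3.Theorems.Transplant.TwoAxisParaCellsFineRep
import Summits.CriticalPhenomena.PercolationContinuityZ3.Theorems.Transplant.SkelPhiPrisms
import HarnessLib

/-!
# N1 ({±1} node), (F) column (hp-8 g33): the FINE CELL LATTICE AS ONE RECORD `Skelφ.FinePrm` — the cell map of record `ψ = fineSkel … (D/2) (D/2) D`,
# the face frame `frame I b` (`vFrame` for faces crossed along cell axis `0`, `uFrame` along axis `1`; raw axis `b`), its Lipschitz / quasi-step
# facts, and the READINGS between the two maps the face step needs: forward (`read_oth`: raw + level window ⇒ the other cell coordinate),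
# inverse (`read_raw`: the two cell coordinates ⇒ the raw coordinate), same frame point (`read_oth_of_frame_eq`), planar diameter of a cell
# box (`sub_mem_box_of_read`), reference vertices (`exists_vertex_ψ_eq`)

builds on p205010 (kernel theorem, internal audit signed; external expert review pending) — nothing in this file uses p205010; deterministic.
Lane `prim-bschramm`, seat `prim-hp-8` (gen 33); helper file (`--supports stmt-CriticalPhenomena-4575 --as helper`); F-COLUMN-N1-PLAN addendum (L1)/(L2)
under p3-g8's ruling of 2026-08-21 14:33Z (`FaceOblAtM`: the window map is chosen PER FACE — it is `frame I b` below).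
Notation: `lvGen 1 = u = (n, h)` (the generator whose dual coordinate `Λ₁ = c₁·A·(n·β − h·α)` is cell coordinate `1`), `lvGen 0 = v = (vα, vβ)`
(`Λ₀ = c₀·A·(vβ·α − vα·β)`), `cOf 0 = c₀`, `cOf 1 = c₁`, `L I = |A|·‖lvGen I‖₁` (Lipschitz constant of `λ_I`), `Mabs = c₀c₁·|A·mod|`,
reading coefficients `rdK I b = c_I·|lvGen I b|` (denominator: reading cell coordinate `oth I` from raw `b` and level `I`) and
`rdN I b = c_{oth I}·|lvGen (oth I) b|` (the level drift numerator); the raw axis of record is `b := argmax_b |lvGen I b|` (then the frame has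
quasi-steps, `qSteps_frame`, and `rdN/rdK ≤ 2·c_{oth I}‖lvGen (oth I)‖/(c_I‖lvGen I‖)`, a bounded drift).
stmt instantiates `⟨800, n_L, h_L, v_L, vβOf …, 20·K·m₀, 20·K·m₁, Dof …⟩`, whose `ψ φ′ t` is `NegPrm.fine φ′ t fcells …` by `rfl`.
[cite: MartineauTassion2017, §4.1 (λ = adj(M)·x), §4.3] [cite: KozmaNitzan2024, §4 p. 30 (Step III: the levels above F^{j+1})]
-/

namespace Summit.CriticalPhenomena.PercolationContinuityZ3.Theorems.Transplant

open Literature.Probability.LatticeModels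

namespace TwoAxis.Para

/-- **The inverse reading lemma**: from an exact identity `M·Δb = k₀·X₀ + k₁·X₁` (`M ≠ 0`) with `|X_i| < (d_i + 1)·D` and the integer room
`(|k₀|(d₀+1) + |k₁|(d₁+1))·D ≤ |M|·(a+1)` (`0 ≤ a`), conclude `|Δb| ≤ a`. [folklore] -/
theorem abs_le_of_two_levels {M Δb k₀ X₀ k₁ X₁ d₀ d₁ a D : ℤ} (hid : M * Δb = k₀ * X₀ + k₁ * X₁) (hM : M ≠ 0)
    (h0 : |X₀| < (d₀ + 1) * D) (h1 : |X₁| < (d₁ + 1) * D) (ha : 0 ≤ a)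
    (hroom : (|k₀| * (d₀ + 1) + |k₁| * (d₁ + 1)) * D ≤ |M| * (a + 1)) : |Δb| ≤ a := by
  have hM0 : 0 < |M| := abs_pos.2 hM
  have hsum : |M| * |Δb| ≤ |k₀| * |X₀| + |k₁| * |X₁| := by
    rw [← abs_mul, hid, ← abs_mul, ← abs_mul]; exact abs_add_le _ _
  by_cases hk : k₀ = 0 ∧ k₁ = 0
  · obtain ⟨rfl, rfl⟩ := hk
    have h0' : M * Δb = 0 := by rw [hid]; ring
    rcases mul_eq_zero.1 h0' with h' | h'
    · exact absurd h' hM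
    · rw [h', abs_zero]; exact ha
  · have hX0 : |k₀| * |X₀| ≤ |k₀| * ((d₀ + 1) * D) := mul_le_mul_of_nonneg_left h0.le (abs_nonneg _)
    have hX1 : |k₁| * |X₁| ≤ |k₁| * ((d₁ + 1) * D) := mul_le_mul_of_nonneg_left h1.le (abs_nonneg _)
    have hlt : |k₀| * |X₀| + |k₁| * |X₁| < (|k₀| * (d₀ + 1) + |k₁| * (d₁ + 1)) * D := by
      rcases not_and_or.1 hk with h' | h'
      · have := mul_lt_mul_of_pos_left h0 (abs_pos.2 h'); nlinarith
      · have := mul_lt_mul_of_pos_left h1 (abs_pos.2 h'); nlinarith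
    have h3 : |M| * |Δb| < |M| * (a + 1) := by linarith
    exact Int.lt_add_one_iff.1 (lt_of_mul_lt_mul_left h3 hM0.le)

end TwoAxis.Para

namespace Skelφ

open Literature.Probability.Percolation.KozmaNitzan.Cells (oth oth_ne eq_oth_of_ne oth_oth)
open Literature.Barriers.CriticalPhenomena (graphBall mem_graphBall_self graphBall_mono)
open TwoAxis.Para (coarse lam0 lam1 modulus detD rep₂)

variable {V : Type} {G : SimpleGraph V} {φ : V → Site 2}

/-- **The parameters of a fine cell lattice** `[A·u  A·v]`, `u = (n, h)`, `v = (vα, vβ)`, with one resolution per axis `c₀, c₁` and the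
determinant slot `D` (`= detD A n h vα vβ` for the column device; only `0 < D` elsewhere). [cite: MartineauTassion2017, §4.1] -/
structure FinePrm where
  /-- the common multiplier of the generators -/
  A : ℤ
  /-- `u = (n, h)` -/
  n : ℤ
  /-- `u = (n, h)` -/
  h : ℤ
  /-- `v = (vα, vβ)` -/
  vα : ℤ
  /-- `v = (vα, vβ)` -/
  vβ : ℤ
  /-- resolution of cell axis `0` -/
  c₀ : ℤ
  /-- resolution of cell axis `1` -/
  c₁ : ℤ
  /-- the determinant slot -/
  D : ℤ

namespace FinePrm

variable (pr : FinePrm)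

/-- **The cell map of record**: `fineSkel` with nearest-cell rounding (offsets `D/2`). [this work] -/
def ψ (φ : V → Site 2) (t : V) : V → Site 2 := fineSkel φ t pr.A pr.n pr.h pr.vα pr.vβ pr.c₀ pr.c₁ (pr.D / 2) (pr.D / 2) pr.D

/-- **The face frame** of a face crossed along cell axis `I`, raw axis `b`: `vFrame` (`I = 0`) / `uFrame` (`I = 1`). [this work] -/
def frame (φ : V → Site 2) (t : V) (I b : Fin 2) : V → Site 2 :=
  if I = 0 then vFrame φ t pr.A pr.vα pr.vβ pr.c₀ (pr.D / 2) pr.D b else uFrame φ t pr.A pr.n pr.h pr.c₁ (pr.D / 2) pr.D b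

/-- The resolution of cell axis `I`. [this work] -/
def cOf (I : Fin 2) : ℤ := if I = 0 then pr.c₀ else pr.c₁

/-- The generator read by cell coordinate `I`: `lvGen 0 = v = (vα, vβ)`, `lvGen 1 = u = (n, h)`. [this work] -/
def lvGen (I : Fin 2) : Site 2 := if I = 0 then ![pr.vα, pr.vβ] else ![pr.n, pr.h]

/-- The Lipschitz constant `|A|·‖lvGen I‖₁` of the dual coordinate `λ_I`. [this work] -/
def L (I : Fin 2) : ℤ := |pr.A| * (|pr.lvGen I 0| + |pr.lvGen I 1|)

/-- The raw modulus `c₀c₁·|A·mod|`. [this work] -/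
def Mabs : ℤ := pr.c₀ * pr.c₁ * |pr.A * modulus pr.n pr.h pr.vα pr.vβ|

/-- Reading denominator `c_I·|lvGen I b|` (cell coordinate `oth I` from raw `b` and cell coordinate `I`). [this work] -/
def rdK (I b : Fin 2) : ℤ := pr.cOf I * |pr.lvGen I b|

/-- Level-drift numerator `c_{oth I}·|lvGen (oth I) b|`. [this work] -/
def rdN (I b : Fin 2) : ℤ := pr.cOf (oth I) * |pr.lvGen (oth I) b|

/-! ## §1 Tables -/


/-- `cOf 0 = c₀`. [folklore] -/
@[simp] theorem cOf_zero : pr.cOf 0 = pr.c₀ := by simp [cOf]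
/-- `cOf 1 = c₁`. [folklore] -/
@[simp] theorem cOf_one : pr.cOf 1 = pr.c₁ := by simp [cOf]
/-- `lvGen 0 0 = vα`. [folklore] -/
@[simp] theorem lvGen_zero_zero : pr.lvGen 0 0 = pr.vα := by simp [lvGen]
/-- `lvGen 0 1 = vβ`. [folklore] -/
@[simp] theorem lvGen_zero_one : pr.lvGen 0 1 = pr.vβ := by simp [lvGen]
/-- `lvGen 1 0 = n`. [folklore] -/
@[simp] theorem lvGen_one_zero : pr.lvGen 1 0 = pr.n := by simp [lvGen]
/-- `lvGen 1 1 = h`. [folklore] -/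
@[simp] theorem lvGen_one_one : pr.lvGen 1 1 = pr.h := by simp [lvGen]

/-- `L 0 = |A|(|vα| + |vβ|)`. [folklore] -/
theorem L_zero : pr.L 0 = |pr.A| * (|pr.vα| + |pr.vβ|) := by simp [L]

/-- `L 1 = |A|(|n| + |h|)`. [folklore] -/
theorem L_one : pr.L 1 = |pr.A| * (|pr.n| + |pr.h|) := by simp [L]

/-- `rdK 0 b = c₀·|v_b|`. [folklore] -/
@[simp] theorem rdK_zero (b : Fin 2) : pr.rdK 0 b = pr.c₀ * |pr.lvGen 0 b| := by simp [rdK]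
/-- `rdK 1 b = c₁·|u_b|`. [folklore] -/
@[simp] theorem rdK_one (b : Fin 2) : pr.rdK 1 b = pr.c₁ * |pr.lvGen 1 b| := by simp [rdK]
/-- `rdN 0 b = c₁·|u_b|`. [folklore] -/
@[simp] theorem rdN_zero (b : Fin 2) : pr.rdN 0 b = pr.c₁ * |pr.lvGen 1 b| := by simp [rdN, show oth (0 : Fin 2) = 1 from rfl]
/-- `rdN 1 b = c₀·|v_b|`. [folklore] -/
@[simp] theorem rdN_one (b : Fin 2) : pr.rdN 1 b = pr.c₀ * |pr.lvGen 0 b| := by simp [rdN, show oth (1 : Fin 2) = 0 from rfl]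

/-! ## §2 The cell map and the face frame: coordinates, base point, Lipschitz, weak steps, quasi-steps -/

/-- The frame along axis `0` is the v-face frame. [folklore] -/
theorem frame_zero (φ : V → Site 2) (t : V) (b : Fin 2) : pr.frame φ t 0 b = vFrame φ t pr.A pr.vα pr.vβ pr.c₀ (pr.D / 2) pr.D b := by
  simp [frame]

/-- The frame along axis `1` is the u-face frame. [folklore] -/
theorem frame_one (φ : V → Site 2) (t : V) (b : Fin 2) : pr.frame φ t 1 b = uFrame φ t pr.A pr.n pr.h pr.c₁ (pr.D / 2) pr.D b := by
  simp [frame]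

/-- **The frame's level coordinate IS the cell coordinate `I`.** [this work] -/
theorem frame_apply_lv (φ : V → Site 2) (t : V) (I b : Fin 2) (w : V) : pr.frame φ t I b w I = pr.ψ φ t w I := by
  obtain rfl | rfl : I = 0 ∨ I = 1 := by fin_cases I <;> simp
  · rw [frame_zero]; exact vFrame_apply_zero t pr.A pr.n pr.h pr.vα pr.vβ pr.c₀ pr.c₁ (pr.D / 2) (pr.D / 2) pr.D b w
  · rw [frame_one]; exact uFrame_apply_one t pr.A pr.n pr.h pr.vα pr.vβ pr.c₀ pr.c₁ (pr.D / 2) (pr.D / 2) pr.D b w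

/-- The frame's other coordinate is the raw coordinate `b`. [folklore] -/
theorem frame_apply_raw (φ : V → Site 2) (t : V) (I b : Fin 2) (w : V) : pr.frame φ t I b w (oth I) = relφ φ t w b := by
  obtain rfl | rfl : I = 0 ∨ I = 1 := by fin_cases I <;> simp
  · rw [frame_zero, show oth (0 : Fin 2) = 1 from rfl]; exact vFrame_apply_one t pr.A pr.vα pr.vβ pr.c₀ (pr.D / 2) pr.D b w
  · rw [frame_one, show oth (1 : Fin 2) = 0 from rfl]; exact uFrame_apply_zero t pr.A pr.n pr.h pr.c₁ (pr.D / 2) pr.D b w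

/-- `⌊(c·0 + D/2)/D⌋ = 0` for `0 < D`. [folklore] -/
theorem coarse_zero {c D : ℤ} (hD : 0 < D) : coarse c (D / 2) D 0 = 0 := by
  unfold coarse; rw [mul_zero, zero_add]; exact Int.ediv_eq_zero_of_lt (Int.ediv_nonneg hD.le (by norm_num)) (by omega)

/-- **Base point**: `ψ t = 0`. [folklore] -/
theorem ψ_base (φ : V → Site 2) (t : V) (hD : 0 < pr.D) : pr.ψ φ t t = 0 := by
  have hrel : relφ φ t t = 0 := by funext i; simp [relφ]
  funext i
  fin_cases i
  · show pr.ψ φ t t 0 = 0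
    simp only [ψ, fineSkel_apply_zero, hrel]; unfold TwoAxis.Para.lam0; simp [coarse_zero hD]
  · show pr.ψ φ t t 1 = 0
    simp only [ψ, fineSkel_apply_one, hrel]; unfold TwoAxis.Para.lam1 TwoAxis.Para.bp; simp [coarse_zero hD]

/-- **Base point of the frame**: `frame I b t = 0`. [folklore] -/
theorem frame_base (φ : V → Site 2) (t : V) (hD : 0 < pr.D) (I b : Fin 2) : pr.frame φ t I b t = 0 := by
  funext k
  by_cases hk : k = I
  · subst hk; rw [frame_apply_lv, ψ_base pr φ t hD]
  · rw [eq_oth_of_ne hk, frame_apply_raw]; simp [relφ]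

/-- **The cell map is 1-Lipschitz** (`c_I·L_I ≤ D`). [cite: MartineauTassion2017, §4.3] -/
theorem lip_ψ (hlip : Lip G φ) (t : V) (hc₀ : 0 ≤ pr.c₀) (hc₁ : 0 ≤ pr.c₁) (hD : 0 < pr.D) (hL0 : pr.c₀ * pr.L 0 ≤ pr.D)
    (hL1 : pr.c₁ * pr.L 1 ≤ pr.D) : Lip G (pr.ψ φ t) := by
  rw [L_zero] at hL0; rw [L_one] at hL1
  exact lip_fineSkel hlip t hc₀ hc₁ hD (by rwa [add_comm]) hL1

/-- **The cell map has weak steps** (from `Steps` of `φ`). [this work] -/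
theorem weakSteps_ψ (hstep : Steps G φ) (t : V) (hc₀ : 0 ≤ pr.c₀) (hc₁ : 0 ≤ pr.c₁) (hD : 0 < pr.D) : WeakSteps G (pr.ψ φ t) :=
  weakSteps_fineSkel hstep t hD hc₀ hc₁

/-- **The frame is 1-Lipschitz** (`c_I·L_I ≤ D`). [this work] -/
theorem lip_frame (hlip : Lip G φ) (t : V) (I b : Fin 2) (hc : 0 ≤ pr.cOf I) (hD : 0 < pr.D) (hL : pr.cOf I * pr.L I ≤ pr.D) :
    Lip G (pr.frame φ t I b) := by
  obtain rfl | rfl : I = 0 ∨ I = 1 := by fin_cases I <;> simp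
  · rw [cOf_zero] at hc; rw [cOf_zero, L_zero] at hL
    rw [frame_zero]; exact lip_vFrame hlip t _ b hc hD (by rwa [add_comm])
  · rw [cOf_one] at hc; rw [cOf_one, L_one] at hL
    rw [frame_one]; exact lip_uFrame hlip t _ b hc hD hL

/-- **The frame has quasi-steps** for the raw axis of record `b = argmax |lvGen I ·|`: `|lvGen I (oth b)| ≤ |lvGen I b| ≠ 0`, `0 < c_I`, `A ≠ 0`,
`c_I·L_I ≤ D ≤ 3·c_I·|A|·|lvGen I b|`. [this work] -/
theorem qSteps_frame (hstep : Steps G φ) (t : V) (I b : Fin 2) (hc : 0 < pr.cOf I) (hA : pr.A ≠ 0) (hD : 0 < pr.D)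
    (hL : pr.cOf I * pr.L I ≤ pr.D) (hb : |pr.lvGen I (oth b)| ≤ |pr.lvGen I b|) (hnz : pr.lvGen I b ≠ 0)
    (hU3 : pr.D ≤ 3 * (pr.cOf I * |pr.A| * |pr.lvGen I b|)) : QSteps G (pr.frame φ t I b) := by
  have hA' : 0 < |pr.A| := abs_pos.2 hA
  obtain rfl | rfl : I = 0 ∨ I = 1 := by fin_cases I <;> simp
  · rw [cOf_zero] at hc hU3; rw [cOf_zero, L_zero] at hL
    have hcf := abs_coef_v pr.c₀ pr.A pr.vα pr.vβ hc.le
    have key : ∀ k : Fin 2, |coef (pr.c₀ * pr.A * pr.vβ) (-(pr.c₀ * pr.A * pr.vα)) k| = pr.c₀ * |pr.A| * |pr.lvGen 0 (oth k)| := by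
      intro k; obtain rfl | rfl : k = 0 ∨ k = 1 := by fin_cases k <;> simp
      · rw [hcf.1, show oth (0 : Fin 2) = 1 from rfl, lvGen_zero_one]
      · rw [hcf.2, show oth (1 : Fin 2) = 0 from rfl, lvGen_zero_zero]
    rw [frame_zero]
    refine qSteps_vFrame hstep t hc.le hD (by rwa [add_comm]) ?_ ?_ ?_
    · rw [key, key, oth_oth]; exact mul_le_mul_of_nonneg_left hb (by positivity)
    · rw [key, oth_oth]; exact mul_pos (mul_pos hc hA') (abs_pos.2 hnz)
    · rw [key, oth_oth]; exact hU3
  · rw [cOf_one] at hc hU3; rw [cOf_one, L_one] at hL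
    have hcf := abs_coef_u pr.c₁ pr.A pr.n pr.h hc.le
    have key : ∀ k : Fin 2, |coef (-(pr.c₁ * pr.A * pr.h)) (pr.c₁ * pr.A * pr.n) k| = pr.c₁ * |pr.A| * |pr.lvGen 1 (oth k)| := by
      intro k; obtain rfl | rfl : k = 0 ∨ k = 1 := by fin_cases k <;> simp
      · rw [hcf.1, show oth (0 : Fin 2) = 1 from rfl, lvGen_one_one]
      · rw [hcf.2, show oth (1 : Fin 2) = 0 from rfl, lvGen_one_zero]
    rw [frame_one]
    refine qSteps_uFrame hstep t hc.le hD hL ?_ ?_ ?_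
    · rw [key, key, oth_oth]; exact mul_le_mul_of_nonneg_left hb (by positivity)
    · rw [key, oth_oth]; exact mul_pos (mul_pos hc hA') (abs_pos.2 hnz)
    · rw [key, oth_oth]; exact hU3

/-- **Frame coordinates in a ball are bounded by the radius** (`frame` 1-Lipschitz, `frame t = 0`). [folklore] -/
theorem abs_frame_le {t : V} {I b : Fin 2} (hlipF : Lip G (pr.frame φ t I b)) (hD : 0 < pr.D) {w : V} {R : ℕ}
    (hw : w ∈ graphBall G t R) (k : Fin 2) : |pr.frame φ t I b w k| ≤ R := by
  have h := abs_sub_le_of_mem_graphBall hlipF hw k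
  rwa [frame_base pr φ t hD, Pi.zero_apply, sub_zero] at h

/-- The frame point of a vertex of `B_G(t, R)` lies in the planar box `[−R, R]²`. [folklore] -/
theorem frame_mem_Icc {t : V} {I b : Fin 2} (hlipF : Lip G (pr.frame φ t I b)) (hD : 0 < pr.D) {w : V} {R : ℕ}
    (hw : w ∈ graphBall G t R) : pr.frame φ t I b w ∈ Finset.Icc (-(R : Site 2)) (R : Site 2) := by
  rw [Finset.mem_Icc]
  constructor <;> intro k <;> have h := abs_le.1 (abs_frame_le pr hlipF hD hw k) <;> simp only [Pi.neg_apply, Pi.natCast_apply] <;> linarith [h.1, h.2]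

/-! ## §3 Readings between the frame and the cell map -/

section Read

variable (t : V) (hc₀ : 0 < pr.c₀) (hc₁ : 0 < pr.c₁) (hD : 0 < pr.D)
include hc₀ hc₁ hD

/-- **FORWARD READING**: raw coordinates `b` within `a` and cell coordinates `I` within `d` give cell coordinates `oth I` within `k`, for
`lvGen I b ≠ 0` and the room `Mabs·a + rdN I b·(d+1)·D ≤ rdK I b·k·D`. [this work] -/
theorem read_oth (I b : Fin 2) (hnz : pr.lvGen I b ≠ 0) {w w' : V} {a d k : ℤ} (ha : |relφ φ t w b - relφ φ t w' b| ≤ a)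
    (hd : |pr.ψ φ t w I - pr.ψ φ t w' I| ≤ d) (hk : pr.Mabs * a + pr.rdN I b * (d + 1) * pr.D ≤ pr.rdK I b * k * pr.D) :
    |pr.ψ φ t w (oth I) - pr.ψ φ t w' (oth I)| ≤ k := by
  unfold Mabs at hk
  simp only [ψ] at hd ⊢
  obtain rfl | rfl : I = 0 ∨ I = 1 := (by fin_cases I <;> simp) <;> obtain rfl | rfl : b = 0 ∨ b = 1 := (by fin_cases b <;> simp)
  · rw [rdN_zero, rdK_zero, lvGen_one_zero, lvGen_zero_zero] at hk; rw [lvGen_zero_zero] at hnz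
    rw [show oth (0 : Fin 2) = 1 from rfl]; exact vFrame_read_one t hc₀ hc₁ hD hnz ha hd (by linarith)
  · rw [rdN_zero, rdK_zero, lvGen_one_one, lvGen_zero_one] at hk; rw [lvGen_zero_one] at hnz
    rw [show oth (0 : Fin 2) = 1 from rfl]; exact vFrame_read_one' t hc₀ hc₁ hD hnz ha hd (by linarith)
  · rw [rdN_one, rdK_one, lvGen_one_zero, lvGen_zero_zero] at hk; rw [lvGen_one_zero] at hnz
    rw [show oth (1 : Fin 2) = 0 from rfl]; exact uFrame_read_zero t hc₀ hc₁ hD hnz ha hd (by linarith)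
  · rw [rdN_one, rdK_one, lvGen_one_one, lvGen_zero_one] at hk; rw [lvGen_one_one] at hnz
    rw [show oth (1 : Fin 2) = 0 from rfl]; exact uFrame_read_zero' t hc₀ hc₁ hD hnz ha hd (by linarith)

/-- **SAME FRAME POINT**: two vertices with the same frame point have the same cell coordinate `I` and cell coordinates `oth I` within `k₀`,
for `rdN I b ≤ rdK I b·k₀` (the drift of one level cell). [this work] -/
theorem read_oth_of_frame_eq (I b : Fin 2) (hnz : pr.lvGen I b ≠ 0) {w w' : V} (hf : pr.frame φ t I b w = pr.frame φ t I b w') {k₀ : ℤ}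
    (hk : pr.rdN I b ≤ pr.rdK I b * k₀) : pr.ψ φ t w I = pr.ψ φ t w' I ∧ |pr.ψ φ t w (oth I) - pr.ψ φ t w' (oth I)| ≤ k₀ := by
  have hI : pr.ψ φ t w I = pr.ψ φ t w' I := by rw [← frame_apply_lv, ← frame_apply_lv, hf]
  have hb : relφ φ t w b = relφ φ t w' b := by rw [← frame_apply_raw, ← frame_apply_raw, hf]
  refine ⟨hI, read_oth pr t hc₀ hc₁ hD I b hnz (a := 0) (d := 0) (by rw [hb, sub_self, abs_zero]) (by rw [hI, sub_self, abs_zero]) ?_⟩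
  have hMa : 0 ≤ pr.Mabs := by unfold Mabs; positivity
  nlinarith [mul_le_mul_of_nonneg_right hk hD.le]

/-- **INVERSE READING**: cell coordinates within `d₀`, `d₁` give raw coordinates `b` within `a`, for `A·mod ≠ 0` and the room
`(rdK 1 b·(d₀+1) + rdK 0 b·(d₁+1))·D ≤ Mabs·(a+1)` (from `![n,h] b·λ₀ + ![vα,vβ] b·λ₁ = A·mod·x_b`). [this work] -/
theorem read_raw (hM : pr.A * modulus pr.n pr.h pr.vα pr.vβ ≠ 0) (b : Fin 2) {w w' : V} {d₀ d₁ a : ℤ} (ha : 0 ≤ a)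
    (h0 : |pr.ψ φ t w 0 - pr.ψ φ t w' 0| ≤ d₀) (h1 : |pr.ψ φ t w 1 - pr.ψ φ t w' 1| ≤ d₁)
    (hroom : (pr.rdK 1 b * (d₀ + 1) + pr.rdK 0 b * (d₁ + 1)) * pr.D ≤ pr.Mabs * (a + 1)) :
    |relφ φ t w b - relφ φ t w' b| ≤ a := by
  simp only [ψ, fineSkel_apply_zero] at h0
  simp only [ψ, fineSkel_apply_one] at h1
  have hX0 := TwoAxis.Para.abs_mul_sub_lt_of_coarse hD h0
  have hX1 := TwoAxis.Para.abs_mul_sub_lt_of_coarse hD h1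
  have e1 := TwoAxis.Para.mul_lam_eq' pr.A pr.n pr.h pr.vα pr.vβ (relφ φ t w)
  have e2 := TwoAxis.Para.mul_lam_eq' pr.A pr.n pr.h pr.vα pr.vβ (relφ φ t w')
  have hid : pr.c₀ * pr.c₁ * (pr.A * modulus pr.n pr.h pr.vα pr.vβ) * (relφ φ t w b - relφ φ t w' b) =
      pr.c₁ * pr.lvGen 1 b * (pr.c₀ * lam0 pr.A pr.vα pr.vβ (relφ φ t w) - pr.c₀ * lam0 pr.A pr.vα pr.vβ (relφ φ t w')) +
        pr.c₀ * pr.lvGen 0 b * (pr.c₁ * lam1 pr.A pr.n pr.h (relφ φ t w) - pr.c₁ * lam1 pr.A pr.n pr.h (relφ φ t w')) := by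
    obtain rfl | rfl : b = 0 ∨ b = 1 := by fin_cases b <;> simp
    · rw [lvGen_one_zero, lvGen_zero_zero]; linear_combination (pr.c₀ * pr.c₁) * (e2.1 - e1.1)
    · rw [lvGen_one_one, lvGen_zero_one]; linear_combination (pr.c₀ * pr.c₁) * (e2.2 - e1.2)
  refine TwoAxis.Para.abs_le_of_two_levels hid (mul_ne_zero (mul_ne_zero hc₀.ne' hc₁.ne') hM) hX0 hX1 ha ?_
  have hk0 : |pr.c₁ * pr.lvGen 1 b| = pr.rdK 1 b := by rw [rdK_one, abs_mul, abs_of_pos hc₁]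
  have hk1 : |pr.c₀ * pr.lvGen 0 b| = pr.rdK 0 b := by rw [rdK_zero, abs_mul, abs_of_pos hc₀]
  have hMM : |pr.c₀ * pr.c₁ * (pr.A * modulus pr.n pr.h pr.vα pr.vβ)| = pr.Mabs := by
    rw [Mabs, abs_mul, abs_mul, abs_of_pos hc₀, abs_of_pos hc₁]
  rw [hk0, hk1, hMM]; exact hroom

/-- **PLANAR DIAMETER OF A CELL BOX**: cell coordinates within `W` in both axes give `φ w − φ w' ∈ [−a, a]²` under the two rooms
`(rdK 1 b + rdK 0 b)·(W+1)·D ≤ Mabs·(a+1)` (`b = 0, 1`). [this work] -/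
theorem sub_mem_box_of_read (hM : pr.A * modulus pr.n pr.h pr.vα pr.vβ ≠ 0) {w w' : V} {W : ℤ} {a : ℕ}
    (h0 : |pr.ψ φ t w 0 - pr.ψ φ t w' 0| ≤ W) (h1 : |pr.ψ φ t w 1 - pr.ψ φ t w' 1| ≤ W)
    (hroom : ∀ b : Fin 2, (pr.rdK 1 b + pr.rdK 0 b) * (W + 1) * pr.D ≤ pr.Mabs * (a + 1)) : φ w - φ w' ∈ box 2 a := by
  rw [mem_box]
  intro b
  have h := read_raw pr t hc₀ hc₁ hD hM b (Int.natCast_nonneg a) h0 h1 (by have := hroom b; linarith)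
  rw [relφ_apply, relφ_apply, show φ w b - φ t b - (φ w' b - φ t b) = φ w b - φ w' b by ring] at h
  exact abs_le.1 h

end Read

/-! ## §4 Reference vertices (the column device of `TwoAxisParaCellsFineRep`, `D = det`) -/

/-- **A vertex with prescribed cell point** `z` lies within graph distance `‖rep₂ z‖₁` of `t` (from `Steps`; `D = detD`, `c_I·L_I + 2 ≤ D`).
[cite: KozmaNitzan2024, §4 p. 26 ((29))] -/
theorem exists_vertex_ψ_eq (hstep : Steps G φ) (t : V) (hc₀ : 0 < pr.c₀) (hc₁ : 0 < pr.c₁) (hDd : pr.D = detD pr.A pr.n pr.h pr.vα pr.vβ)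
    (hD : 0 < pr.D) (hL0 : pr.c₀ * pr.L 0 + 2 ≤ pr.D) (hL1 : pr.c₁ * pr.L 1 + 2 ≤ pr.D) (z : Site 2) {R : ℕ}
    (hR : (rep₂ pr.A pr.n pr.h pr.vα pr.vβ pr.c₀ pr.c₁ z 0).natAbs + (rep₂ pr.A pr.n pr.h pr.vα pr.vβ pr.c₀ pr.c₁ z 1).natAbs ≤ R) :
    ∃ y ∈ graphBall G t R, pr.ψ φ t y = z := by
  rw [L_zero, add_comm |pr.vα|] at hL0; rw [L_one] at hL1
  rw [hDd] at hD hL0 hL1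
  obtain ⟨g, hg, hgz⟩ := exists_mem_graphBall_fineSkel_eq hstep t hc₀ hc₁ hD hL0 hL1 z
  exact ⟨g, graphBall_mono G t hR hg, by rw [ψ, hDd]; exact hgz⟩

/-- `D = A²·mod > 0` forces `A·mod ≠ 0` (the hypothesis of the inverse reading). [folklore] -/
theorem A_mul_modulus_ne_zero (hDd : pr.D = detD pr.A pr.n pr.h pr.vα pr.vβ) (hD : 0 < pr.D) :
    pr.A * modulus pr.n pr.h pr.vα pr.vβ ≠ 0 := by
  intro h0
  rw [hDd, TwoAxis.Para.detD, pow_two, mul_assoc, h0, mul_zero] at hD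
  exact lt_irrefl _ hD

end FinePrm

end Skelφ

end Summit.CriticalPhenomena.PercolationContinuityZ3.Theorems.Transplant
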